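import Summits.ABC.ABC.Theorems.RibetTakahashiSplitThinWeightedSzpiroDefs
import Summits.ABC.ABC.Theorems.RibetTakahashiSplitThinWeightedSzpiroStubLocalData
import Summits.ABC.ABC.Theorems.RibetTakahashiSplitThinWeightedSzpiroStubWeights
import Summits.ABC.ABC.Theorems.RibetTakahashiSplitThinWeightedSzpiroStubTransfer
import Literature.NumberTheory.DiophantineGeometry.StrongHall
import Literature.NumberTheory.EllipticCurves.SzpiroHallProofs

/-!
# Position of line `Sketch` for crux `RibetTakahashiSplit.ThinWeightedSzpiro` (item stmt-ABC-17927):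
strong Hall ⟹ the ℕ normal form ⟹ the crux

Registered sub-goal `thinStrongHall_of_strongHall` (via `ledger workitem stub-add`, uncurried signature) of the line (lead prover-line-stmt-ABC-17927-0; proof by the
line's bulk worker, wave 1): the strong Hall conjecture (Bombieri–Gubler, *Heights in Diophantine Geometry*,
Conj. 12.5.3, `Literature.NumberTheory.DiophantineGeometry.StrongHallConjecture`; equivalent to `abc` by B–G
Thm. 12.5.12, tree `abcLe_iff_strongHall`) implies the line's normal form `ThinStrongHall`
(`RibetTakahashiSplitThinWeightedSzpiroDefs`), even without its thinness hypothesis and with `rad5 z` alone in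
place of `rad5 z · wt5 z`. Consequences recorded here: both research stubs of the skeleton
(`ThinStrongHallCusp`, `ThinStrongHallBulk`) follow from strong Hall, and — composing with the LANDED bookkeeping
stubs `stub_transfer`, `stub_localData`, `stub_weights` — so does the crux:
`thinWeightedSzpiro_of_strongHall : StrongHallConjecture → ThinWeightedSzpiro` (a CONDITIONAL result; the crux
itself stays open). So the normal form is not "cheaper-than-abc wrong": nothing refutes the line's research
stubs short of `¬abc` (the crux disprover's `Disproof.lean` §6 reaches the same verdict independently).

Route (B–G, proof of 12.5.12 (b) ⟹ (c), with the minimality input replaced by the side conditions of the normal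
form): write `GCD (x³, y²) = Γ' g⁶` with `Γ'` sixth-power free (`exists_factorization_eq_div_six`); then
`(x/g², y/g³, z/g⁶)` is a primitive solution (B–G 12.5.2); `Prim23 ∧ 1728 ∣ z` give `v₂(x) ≤ 7 ∨ v₂(y) ≤ 10`
and `v₃(x) ≤ 4 ∨ v₃(y) ≤ 8`, whence `v₂(g) ≤ 3`, `v₃(g) ≤ 2` (`factorization_gcd_le_of_not_pow_dvd`), and the
coprimality condition gives `v_p(g) = 0` for `p ≥ 5`, so `g ∣ 72`; strong Hall for the primitive solution and
`rad (z/g⁶) ≤ rad |z| ≤ 6 · rad5 z` give `max (|z|, |x|³) ≤ 2 · 72⁶ · max(C(ε/3),1)³ · 6^{6+ε} (rad5 z)^{6+ε}`.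
-/

-- `Summit.<Summit>.<Problem>` is the mandated summit-side namespace (CONVENTIONS §2); for the
-- single-conjunct summit `ABC` the two coincide, so the duplicate `ABC.ABC` is deliberate.
set_option linter.dupNamespace false

namespace Summit.ABC.ABC.Theorems.ThinWeightedSzpiro

open UniqueFactorizationMonoid Real
open Summit.ABC.ABC.Theses.RibetTakahashiSplit
open Literature.NumberTheory.DiophantineGeometry (StrongHallConjecture IsPrimitiveHallSolution)
open Literature.NumberTheory.EllipticCurves (exists_factorization_eq_div_six
  factorization_gcd_le_of_not_pow_dvd pow_natCast_dvd_of_factorization_le)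

/-! ## §1 `rad5`, `wt5` are blind to `{2,3}`-factors -/

/-- Multiplying by a `{2,3}`-unit-like factor does not change the set of prime factors `≥ 5`. -/
theorem filter_five_le_primeFactors_mul {u n : ℕ} (hu0 : u ≠ 0) (hn : n ≠ 0)
    (hu : ∀ p ∈ u.primeFactors, p < 5) :
    (u * n).primeFactors.filter (5 ≤ ·) = n.primeFactors.filter (5 ≤ ·) := by
  rw [Nat.primeFactors_mul hu0 hn, Finset.filter_union]
  have h : u.primeFactors.filter (5 ≤ ·) = ∅ := by
    rw [Finset.filter_eq_empty_iff]
    intro p hp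
    have := hu p hp
    omega
  rw [h, Finset.empty_union]

/-- `rad5 (u z) = rad5 z` when all prime factors of `u ≠ 0` are `< 5`. -/
theorem rad5_mul_eq {u : ℤ} (hu0 : u ≠ 0) (hu : ∀ p ∈ u.natAbs.primeFactors, p < 5) (z : ℤ) :
    rad5 (u * z) = rad5 z := by
  by_cases hz : z = 0
  · simp [hz]
  unfold rad5
  rw [Int.natAbs_mul, filter_five_le_primeFactors_mul (Int.natAbs_ne_zero.mpr hu0)
    (Int.natAbs_ne_zero.mpr hz) hu]

/-- `wt5 (u z) = wt5 z` when all prime factors of `u ≠ 0` are `< 5`. -/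
theorem wt5_mul_eq {u : ℤ} (hu0 : u ≠ 0) (hu : ∀ p ∈ u.natAbs.primeFactors, p < 5) (z : ℤ) :
    wt5 (u * z) = wt5 z := by
  by_cases hz : z = 0
  · simp [hz]
  have hu0' := Int.natAbs_ne_zero.mpr hu0
  have hz' := Int.natAbs_ne_zero.mpr hz
  unfold wt5
  rw [Int.natAbs_mul, filter_five_le_primeFactors_mul hu0' hz' hu]
  refine Finset.prod_congr rfl fun p hp => ?_
  rw [Finset.mem_filter] at hp
  rw [Nat.factorization_mul hu0' hz', Finsupp.add_apply]
  have h0 : u.natAbs.factorization p = 0 := by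
    apply Nat.factorization_eq_zero_of_not_dvd
    intro hd
    have := hu p (Nat.mem_primeFactors.mpr ⟨Nat.prime_of_mem_primeFactors hp.1, hd, hu0'⟩)
    omega
  rw [h0, zero_add]

/-! ## §2 Strong Hall ⟹ the normal form -/

/-- **Position lemma.** The strong Hall conjecture (Bombieri–Gubler, *Heights in Diophantine Geometry*,
Conj. 12.5.3; `abc`-equivalent by Thm. 12.5.12) implies the ℕ normal form `ThinStrongHall` with class
exponent `θ = 1` (any `θ` works: the thinness hypothesis is not used) and constant
`2 · 72⁶ · max(C(ε/3),1)³ · 6^{6+ε}`. Route of B–G's proof of 12.5.12 (b) ⟹ (c): write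
`GCD (x³, y²) = Γ' g⁶` with `Γ'` sixth-power free (`exists_factorization_eq_div_six`); then
`(x/g², y/g³, z/g⁶)` is a primitive solution; `Prim23 ∧ 1728 ∣ z` give `v₂(x) ≤ 7 ∨ v₂(y) ≤ 10` and
`v₃(x) ≤ 4 ∨ v₃(y) ≤ 8`, whence `v₂(g) ≤ 3`, `v₃(g) ≤ 2` (`factorization_gcd_le_of_not_pow_dvd`), and the
coprimality condition gives `v_p(g) = 0` for `p ≥ 5`, so `g ∣ 72`; finally `rad (z/g⁶) ≤ rad |z| ≤ 6 rad5 z`,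
`|z| ≤ |x|³ + y²`, `1 ≤ wt5 z`. -/
theorem thinStrongHall_of_strongHall :
    Literature.NumberTheory.DiophantineGeometry.StrongHallConjecture →
      Summit.ABC.ABC.Theorems.ThinWeightedSzpiro.ThinStrongHall := by
  intro hH
  refine ⟨1, one_pos, fun ε hε K => ?_⟩
  obtain ⟨C₀, hC₀⟩ := hH (ε / 3) (by positivity)
  set C : ℝ := max C₀ 1 with hCdef
  have hC1 : 1 ≤ C := le_max_right _ _
  have hC0 : 0 < C := one_pos.trans_le hC1
  set e : ℝ := 6 + ε with hedef
  have he0 : 0 ≤ e := by positivity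
  set Kc : ℝ := 72 ^ 6 * C ^ 3 * 6 ^ e with hKc
  have hKc0 : 0 ≤ Kc := by positivity
  refine ⟨2 * Kc, fun x y hz h1728 hprim _ hcop _ => ?_⟩
  -- `Γ = GCD (x³, y²) = Γ' g⁶`
  set Γ : ℕ := Int.gcd (x ^ 3) (y ^ 2) with hΓdef
  have hΓ0 : Γ ≠ 0 := by
    intro h
    rw [hΓdef, Int.gcd_eq_zero_iff] at h
    apply hz
    rw [h.1, h.2, sub_zero]
  obtain ⟨g, hg0, hgfac⟩ := exists_factorization_eq_div_six Γ
  have hΓx : (Γ : ℤ) ∣ x ^ 3 := Int.gcd_dvd_left _ _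
  have hΓy : (Γ : ℤ) ∣ y ^ 2 := Int.gcd_dvd_right _ _
  have hfacΓ : ∀ {c : ℤ} {n : ℕ}, c ≠ 0 → (Γ : ℤ) ∣ c ^ n → ∀ p : ℕ, p.Prime →
      Γ.factorization p ≤ n * c.natAbs.factorization p := by
    intro c n hc hdvd p hp
    have hcn : c.natAbs ≠ 0 := Int.natAbs_ne_zero.mpr hc
    have hdvd' : Γ ∣ c.natAbs ^ n := by
      rw [← Int.natAbs_pow]; exact Int.natCast_dvd.mp hdvd
    have hle := Nat.factorization_le_factorization_of_dvd_right hdvd' hΓ0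
      (pow_ne_zero _ hcn) (a := p)
    rw [Nat.factorization_pow] at hle
    simpa using hle
  have hg2 : (g : ℤ) ^ 2 ∣ x := by
    by_cases h0 : x = 0
    · rw [h0]; exact dvd_zero _
    refine pow_natCast_dvd_of_factorization_le hg0 h0 fun p hp ↦ ?_
    have := hfacΓ h0 hΓx p hp
    rw [hgfac]; omega
  have hg3 : (g : ℤ) ^ 3 ∣ y := by
    by_cases h0 : y = 0
    · rw [h0]; exact dvd_zero _
    refine pow_natCast_dvd_of_factorization_le hg0 h0 fun p hp ↦ ?_
    have := hfacΓ h0 hΓy p hp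
    rw [hgfac]; omega
  obtain ⟨x', hx'⟩ := hg2
  obtain ⟨y', hy'⟩ := hg3
  set z' : ℤ := x' ^ 3 - y' ^ 2 with hz'def
  have hg0' : (g : ℤ) ≠ 0 := by exact_mod_cast hg0
  have hgz : (g : ℤ) ^ 6 * z' = x ^ 3 - y ^ 2 := by rw [hx', hy', hz'def]; ring
  have hz'0 : z' ≠ 0 := by
    intro h
    rw [h, mul_zero] at hgz
    exact hz hgz.symm
  -- primitivity of `(x', y', z')`
  have hΓ' : Γ = g ^ 6 * Int.gcd (x' ^ 3) (y' ^ 2) := by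
    rw [hΓdef, hx', hy', mul_pow, mul_pow, ← pow_mul, ← pow_mul, Int.gcd_mul_left,
      Int.natAbs_pow, Int.natAbs_natCast]
  have hprimsol : IsPrimitiveHallSolution x' y' z' := by
    refine ⟨rfl, hz'0, fun d hd ↦ ?_⟩
    set Γ₁ := Int.gcd (x' ^ 3) (y' ^ 2) with hΓ₁
    have hΓ₁0 : Γ₁ ≠ 0 := by
      intro h; exact hΓ0 (by rw [hΓ', h, mul_zero])
    by_contra hd1
    have hd0 : d ≠ 0 := by
      rintro rfl
      exact hΓ₁0 (Nat.eq_zero_of_zero_dvd (by simpa using hd))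
    obtain ⟨q, hq, hqd⟩ := Nat.exists_prime_and_dvd hd1
    have hq6 : q ^ 6 ∣ Γ₁ := dvd_trans (pow_dvd_pow_of_dvd hqd 6) hd
    have h6 : 6 ≤ Γ₁.factorization q := (hq.pow_dvd_iff_le_factorization hΓ₁0).mp hq6
    have hfac : Γ.factorization q = 6 * g.factorization q + Γ₁.factorization q := by
      rw [hΓ', Nat.factorization_mul (pow_ne_zero _ hg0) hΓ₁0, Nat.factorization_pow]
      simp
    have := hgfac q
    omega
  -- strong Hall for `(x', y', z')`
  obtain ⟨hHx, hHy⟩ := hC₀ x' y' z' hprimsol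
  set Rz : ℝ := ((radical z'.natAbs : ℕ) : ℝ) with hRz
  have hRz0 : 0 ≤ Rz := by positivity
  have hHx' : |(x' : ℝ)| ≤ C * Rz ^ (2 + ε / 3) :=
    hHx.trans (mul_le_mul_of_nonneg_right (le_max_left _ _) (by positivity))
  have hHy' : |(y' : ℝ)| ≤ C * Rz ^ (3 + ε / 3) :=
    hHy.trans (mul_le_mul_of_nonneg_right (le_max_left _ _) (by positivity))
  -- the side conditions bound `g`: `v₂(g) ≤ 3`, `v₃(g) ≤ 2`, `v_p(g) = 0` for `p ≥ 5`
  have h27 : (27 : ℤ) ∣ x ^ 3 - y ^ 2 := dvd_trans ⟨64, by norm_num⟩ h1728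
  have h64 : (64 : ℤ) ∣ x ^ 3 - y ^ 2 := dvd_trans ⟨27, by norm_num⟩ h1728
  have hgle : ∀ p : ℕ, p.Prime →
      g.factorization p ≤ if p = 2 then 3 else if p = 3 then 2 else 0 := by
    intro p hp
    rw [hgfac]
    by_cases h2 : p = 2
    · subst h2
      rw [if_pos rfl]
      -- `Prim23 ∧ 27 ∣ z ⟹ ¬ 2⁸ ∣ x ∨ ¬ 2¹¹ ∣ y`
      have hor : ¬ (2 : ℤ) ^ 8 ∣ x ∨ ¬ (2 : ℤ) ^ 11 ∣ y := by
        by_contra hand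
        push Not at hand
        obtain ⟨h8, h11⟩ := hand
        apply hprim.1
        refine ⟨h8, h11, ?_⟩
        have h22 : (2 : ℤ) ^ 18 ∣ x ^ 3 - y ^ 2 := by
          refine dvd_sub (dvd_trans ?_ (pow_dvd_pow_of_dvd h8 3))
            (dvd_trans ?_ (pow_dvd_pow_of_dvd h11 2))
          · rw [← pow_mul]; exact pow_dvd_pow 2 (by norm_num)
          · rw [← pow_mul]; exact pow_dvd_pow 2 (by norm_num)
        have hcop2 : IsCoprime ((2 : ℤ) ^ 18) 27 := by
          rw [Int.isCoprime_iff_gcd_eq_one]; decide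
        rw [show (2 : ℤ) ^ 12 * 1728 = 2 ^ 18 * 27 by norm_num]
        exact hcop2.mul_dvd h22 h27
      have key := factorization_gcd_le_of_not_pow_dvd (c₄ := x) (c₆ := y) (e₄ := 4) (e₆ := 5)
        Nat.prime_two (by simpa using hor)
      rw [← hΓdef] at key
      omega
    by_cases h3 : p = 3
    · subst h3
      rw [if_neg (by norm_num), if_pos rfl]
      -- `Prim23 ∧ 64 ∣ z ⟹ ¬ 3⁵ ∣ x ∨ ¬ 3⁹ ∣ y`
      have hor : ¬ (3 : ℤ) ^ 5 ∣ x ∨ ¬ (3 : ℤ) ^ 9 ∣ y := by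
        by_contra hand
        push Not at hand
        obtain ⟨h5, h9⟩ := hand
        apply hprim.2
        refine ⟨dvd_trans (pow_dvd_pow 3 (by norm_num)) h5, h9, ?_⟩
        have h15 : (3 : ℤ) ^ 15 ∣ x ^ 3 - y ^ 2 := by
          refine dvd_sub (dvd_trans ?_ (pow_dvd_pow_of_dvd h5 3))
            (dvd_trans ?_ (pow_dvd_pow_of_dvd h9 2))
          · rw [← pow_mul]
          · rw [← pow_mul]; exact pow_dvd_pow 3 (by norm_num)
        have hcop3 : IsCoprime ((3 : ℤ) ^ 15) 64 := by
          rw [Int.isCoprime_iff_gcd_eq_one]; decide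
        rw [show (3 : ℤ) ^ 12 * 1728 = 3 ^ 15 * 64 by norm_num]
        exact hcop3.mul_dvd h15 h64
      have key := factorization_gcd_le_of_not_pow_dvd (c₄ := x) (c₆ := y) (e₄ := 1) (e₆ := 3)
        Nat.prime_three (by simpa using hor)
      rw [← hΓdef] at key
      omega
    · rw [if_neg h2, if_neg h3]
      have h5 : 5 ≤ p := by
        have := hp.two_le
        by_contra h
        interval_cases p <;> first | exact absurd hp (by decide) | omega
      -- a prime `p ≥ 5` dividing `Γ` divides `x` and `z`: excluded
      have hΓp : Γ.factorization p = 0 := by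
        apply Nat.factorization_eq_zero_of_not_dvd
        intro hpΓ
        have hpΓ' : (p : ℤ) ∣ (Γ : ℤ) := Int.natCast_dvd_natCast.mpr hpΓ
        have hpint : Prime (p : ℤ) := Nat.prime_iff_prime_int.mp hp
        have hpx : (p : ℤ) ∣ x := hpint.dvd_of_dvd_pow (hpΓ'.trans hΓx)
        have hpy : (p : ℤ) ∣ y := hpint.dvd_of_dvd_pow (hpΓ'.trans hΓy)
        exact hcop p hp h5 hpx (dvd_sub (dvd_pow hpx three_ne_zero) (dvd_pow hpy two_ne_zero))
      rw [hΓp]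
  have hg72 : g ∣ 72 := by
    rw [← Nat.factorization_le_iff_dvd hg0 (by norm_num)]
    intro p
    by_cases hp : p.Prime
    swap
    · simp [Nat.factorization_eq_zero_of_not_prime _ hp]
    have h72 : (72 : ℕ).factorization p = (if p = 2 then 3 else 0) + (if p = 3 then 2 else 0) := by
      rw [show (72 : ℕ) = 2 ^ 3 * 3 ^ 2 by norm_num, Nat.factorization_mul (by norm_num) (by norm_num),
        Finsupp.add_apply, Nat.Prime.factorization_pow Nat.prime_two,
        Nat.Prime.factorization_pow Nat.prime_three, Finsupp.single_apply, Finsupp.single_apply]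
      simp only [eq_comm]
    have hgp := hgle p hp
    rw [h72]
    by_cases h2 : p = 2
    · subst h2; simp only [if_true] at hgp ⊢; omega
    by_cases h3 : p = 3
    · subst h3; simp only [h2, if_true, if_false] at hgp ⊢; omega
    · simp only [h2, h3, if_false] at hgp ⊢; omega
  -- `rad (z') ≤ rad |z| ≤ 6 rad5 z`
  set z : ℤ := x ^ 3 - y ^ 2 with hzdef
  have hzn : z.natAbs ≠ 0 := Int.natAbs_ne_zero.mpr hz
  have hradz : radical z'.natAbs ≤ 6 * rad5 z := by
    have hdvd : z'.natAbs ∣ z.natAbs :=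
      Int.natAbs_dvd_natAbs.mpr ⟨(g : ℤ) ^ 6, by rw [← hgz]; ring⟩
    have h1 : radical z'.natAbs ∣ radical z.natAbs := radical_dvd_radical hdvd hzn
    have h2 : radical z.natAbs ∣ 6 * rad5 z := by
      unfold rad5
      rw [Nat.radical_eq_prod_primeFactors,
        ← Finset.prod_filter_mul_prod_filter_not z.natAbs.primeFactors (fun p => 5 ≤ p), mul_comm 6]
      refine mul_dvd_mul_left _ ?_
      have hsub : z.natAbs.primeFactors.filter (fun p => ¬ 5 ≤ p) ⊆ ({2, 3} : Finset ℕ) := by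
        intro p hp
        rw [Finset.mem_filter] at hp
        have hp' : p.Prime := Nat.prime_of_mem_primeFactors hp.1
        have h2 := hp'.two_le
        have : p < 5 := not_le.mp hp.2
        rw [Finset.mem_insert, Finset.mem_singleton]
        interval_cases p
        · exact Or.inl rfl
        · exact Or.inr rfl
        · exact absurd hp' (by decide)
      have h6 : ∏ p ∈ ({2, 3} : Finset ℕ), p = 6 := by
        rw [Finset.prod_pair (by norm_num)]; norm_num
      calc ∏ p ∈ z.natAbs.primeFactors.filter (fun p => ¬ 5 ≤ p), p
          ∣ ∏ p ∈ ({2, 3} : Finset ℕ), p := Finset.prod_dvd_prod_of_subset _ _ _ hsub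
        _ = 6 := h6
    have hpos : 0 < 6 * rad5 z := Nat.mul_pos (by norm_num) (one_le_rad5 z)
    exact (Nat.le_of_dvd (Nat.radical_pos _) h1).trans (Nat.le_of_dvd hpos h2)
  -- real numbers
  set R : ℝ := (rad5 z : ℝ) with hR
  set W : ℝ := (wt5 z : ℝ) with hW
  have hR1 : 1 ≤ R := by rw [hR]; exact_mod_cast one_le_rad5 z
  have hW1 : 1 ≤ W := by rw [hW]; exact_mod_cast one_le_wt5 z
  have hR0 : 0 ≤ R := by linarith
  have hRzle : Rz ≤ 6 * R := by rw [hRz, hR]; exact_mod_cast hradz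
  have hRz1 : 1 ≤ Rz := by rw [hRz]; exact_mod_cast Nat.radical_pos _
  have hg6 : (g : ℝ) ^ 6 ≤ 72 ^ 6 := by
    have : (g : ℝ) ≤ 72 := by exact_mod_cast Nat.le_of_dvd (by norm_num) hg72
    exact pow_le_pow_left₀ (by positivity) this 6
  have hRW : R ^ e ≤ (R * W) ^ e :=
    Real.rpow_le_rpow hR0 (le_mul_of_one_le_right hR0 hW1) he0
  -- the common estimate for `|x|³ = g⁶ |x'|³` and `|y|² = g⁶ |y'|²`
  have key : ∀ (u : ℝ) (k : ℕ) (s : ℝ), 0 ≤ u → u ≤ C * Rz ^ s → (k : ℝ) * s ≤ e → k ≤ 3 →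
      (g : ℝ) ^ 6 * u ^ k ≤ Kc * (R * W) ^ e := by
    intro u k s hu0 hu hks hk3
    have h1 : u ^ k ≤ C ^ 3 * (6 ^ e * (R * W) ^ e) := by
      calc u ^ k ≤ (C * Rz ^ s) ^ k := pow_le_pow_left₀ hu0 hu k
        _ = C ^ k * Rz ^ ((k : ℝ) * s) := by
          rw [mul_pow, ← Real.rpow_natCast (Rz ^ s) k, ← Real.rpow_mul hRz0, mul_comm s]
        _ ≤ C ^ 3 * Rz ^ e :=
          mul_le_mul (pow_le_pow_right₀ hC1 hk3) (Real.rpow_le_rpow_of_exponent_le hRz1 hks)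
            (by positivity) (by positivity)
        _ ≤ C ^ 3 * (6 * R) ^ e :=
          mul_le_mul_of_nonneg_left (Real.rpow_le_rpow hRz0 hRzle he0) (by positivity)
        _ = C ^ 3 * (6 ^ e * R ^ e) := by rw [Real.mul_rpow (by norm_num) hR0]
        _ ≤ C ^ 3 * (6 ^ e * (R * W) ^ e) :=
          mul_le_mul_of_nonneg_left (mul_le_mul_of_nonneg_left hRW (by positivity)) (by positivity)
    calc (g : ℝ) ^ 6 * u ^ k ≤ 72 ^ 6 * (C ^ 3 * (6 ^ e * (R * W) ^ e)) :=
          mul_le_mul hg6 h1 (by positivity) (by positivity)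
      _ = Kc * (R * W) ^ e := by rw [hKc]; ring
  have hx3 : |(x : ℝ)| ^ 3 ≤ Kc * (R * W) ^ e := by
    have h : |(x : ℝ)| ^ 3 = (g : ℝ) ^ 6 * |(x' : ℝ)| ^ 3 := by
      rw [hx']; push_cast
      rw [abs_mul, abs_of_nonneg (by positivity : (0 : ℝ) ≤ (g : ℝ) ^ 2)]; ring
    rw [h]
    exact key _ 3 _ (abs_nonneg _) hHx' (by rw [hedef]; push_cast; linarith) le_rfl
  have hy2 : |(y : ℝ)| ^ 2 ≤ Kc * (R * W) ^ e := by
    have h : |(y : ℝ)| ^ 2 = (g : ℝ) ^ 6 * |(y' : ℝ)| ^ 2 := by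
      rw [hy']; push_cast
      rw [abs_mul, abs_of_nonneg (by positivity : (0 : ℝ) ≤ (g : ℝ) ^ 3)]; ring
    rw [h]
    exact key _ 2 _ (abs_nonneg _) hHy' (by rw [hedef]; push_cast; linarith) (by norm_num)
  have hKRW : 0 ≤ Kc * (R * W) ^ e := by positivity
  have hzle : |((z : ℤ) : ℝ)| ≤ 2 * Kc * (R * W) ^ e := by
    have hzR : ((z : ℤ) : ℝ) = (x : ℝ) ^ 3 - (y : ℝ) ^ 2 := by rw [hzdef]; push_cast; ring
    calc |((z : ℤ) : ℝ)| = |(x : ℝ) ^ 3 - (y : ℝ) ^ 2| := by rw [hzR]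
      _ ≤ |(x : ℝ) ^ 3| + |(y : ℝ) ^ 2| := abs_sub _ _
      _ = |(x : ℝ)| ^ 3 + |(y : ℝ)| ^ 2 := by rw [abs_pow, abs_pow]
      _ ≤ Kc * (R * W) ^ e + Kc * (R * W) ^ e := add_le_add hx3 hy2
      _ = 2 * Kc * (R * W) ^ e := by ring
  -- conclusion
  rw [Int.cast_max, Int.cast_pow, Int.cast_abs, Int.cast_abs]
  refine max_le hzle (hx3.trans ?_)
  linarith

/-- **Position of `stub_bulk`**: the strong Hall conjecture (B–G Conj. 12.5.3, `abc`-equivalent) implies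
`ThinStrongHallBulk`. -/
theorem thinStrongHallBulk_of_strongHall (hH : StrongHallConjecture) : ThinStrongHallBulk :=
  thinStrongHallBulk_of_thinStrongHall (thinStrongHall_of_strongHall hH)

/-- Corollary: strong Hall implies the CUSP research stub's statement `ThinStrongHallCusp`. -/
theorem thinStrongHallCusp_of_strongHall (hH : StrongHallConjecture) : ThinStrongHallCusp :=
  thinStrongHallCusp_of_thinStrongHall (thinStrongHall_of_strongHall hH)

/-- **The line's net position (conditional result).** Strong Hall (B–G Conj. 12.5.3, `abc`-equivalent)
implies the crux `RibetTakahashiSplit.ThinWeightedSzpiro`, through the ℕ normal form and the landed bookkeeping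
stubs `stub_transfer stub_localData stub_weights`. The crux itself remains OPEN; this only certifies that the
line's reduction loses nothing that `abc` does not already give. -/
theorem thinWeightedSzpiro_of_strongHall (hH : StrongHallConjecture) : ThinWeightedSzpiro :=
  stub_transfer stub_localData stub_weights (thinStrongHall_of_strongHall hH)

end Summit.ABC.ABC.Theorems.ThinWeightedSzpiro
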